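import Summits.AtomisticToContinuum.Crystallization.Theorems.FreeSplittingCertificatesStrictSplittingRuleP1Reproduce
import Summits.AtomisticToContinuum.Crystallization.Theorems.FreeSplittingCertificatesStrictSplittingRuleP1CellSum

/-!
# `StrictSplittingRule` (stmt-AtomisticToContinuum-12560): FLUX IDENTIFICATION — the far theorem's boundary term for the P1 interpolant IS a cellwise finite quadratic form of the vertex values (P1 interpolant object, part 41)

Route `FreeSplittingCertificates`, crux r3 `StrictSplittingRule` (H12⋆ = `stub_coreJointCoercive`), unit b2b-freesplit-B gen 29.
VALUE = item (3) "flux identification" of HOME FAR-LEMMA-SPEC §20 (e) / CERT §29 (3), kernel half: the boundary ("flux") term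
`∫ 2χ⟪∇χ, Φ(v)⟫` of the far theorem for the far-ledger field `v = p1Disp a h U b₀ A` (`farPencil4_weighted_integral_le_p1Disp`,
generic flux `Φ = aΦ₁ + bΦ₂ + cΦ₃ + nΨ₁`, ledger weight `χ = fpChi S₁ S₂`) is IDENTIFIED with the cellwise sum of an explicit
finite-dimensional form in the four vertex values `W_m` and the (constant) element gradient `G` of each cell
(**`integral_flux_p1Disp_eq_tsum`**):
`∫ 2χ⟪∇χ, Φ(v)⟫ = Σ'_T [ Σ_{m₁m₂} a(Σ_k W_{m₁k}W_{m₂k})·A_T(m₁,m₂) + Σ_{m₁m₂jl} (b+c)W_{m₁j}W_{m₂l}·B_T(m₁,m₂,j,l)`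
`                      + Σ_{m,j} n(Σ_k W_{mk}G_{kj} − tr G·W_{mj})·C_T(m,j) ]`
with the cell coefficient integrals `A_T = ∫_T g₃λ_{m₁}λ_{m₂}`, `B_T = ∫_T g₄λ_{m₁}λ_{m₂}y_jy_l`, `C_T = ∫_T g₃λ_m y_j`,
`g_k(y) = 4χ(y)χ′(|y|²)|y|⁻²ᵏ`, `χ′ = dχ/ds = S₁(t)/(S₂−S₁)`.  These `12 × 12` cell forms are exactly what the gen-29 engine
`fluxform.py` encloses in ball arithmetic and what the "v9" near ledger pays (`κ·F`): after this part the near side pays LITERALLY the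
far theorem's boundary term — no identification between a site-quadrature proxy and the interpolant's flux is needed.  Ingredients:
the interface density `two_chi_fpFlux4DotGrad_fpChi`, `p1Disp = p1Field ∘ p1DispSite` (linear precision, part 30), `p1Field = Σ_m λ_m W_m`
on a cell, `fpGrad = G` a.e. on the cell (`fpGrad_p1Disp_ae`), the cells decomposition `integral_eq_tsum_p1RealCell`, and integrability of
the interface integrand from the Lipschitz bound of the field (`exists_lipschitzWith_p1Disp`, `abs_fpFlux4_le`, `integrable_fluxBound`).
NOT a proof of H12⋆, NOT summit progress.  [folklore: P1 finite elements]
-/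

noncomputable section

open Set Function Metric MeasureTheory Filter Topology
open scoped BigOperators NNReal ENNReal

namespace Summit.AtomisticToContinuum.Crystallization.Theorems.StrictSplittingRuleBirth

/-! ## The radial flux profiles, the cell coefficient integrals, the cell flux form -/

/-- The scalar prefactor `4χ(y)·χ′(|y|²)` of the interface density (`χ′ = dχ/ds = S₁(t)/(S₂−S₁)`). -/
def fpFluxPre (S1 S2 : ℝ) (y : Fin 3 → ℝ) : ℝ :=
  4 * fpChi S1 S2 y * (fpSmoothstep1 ((fpSq y - S1) / (S2 - S1)) / (S2 - S1))

/-- The radial flux profile `g_k(y) = 4χ(y)·χ′(|y|²)·|y|⁻²ᵏ` (supported in the collar `S₁ < |y|² < S₂`). -/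
def fpFluxProfile (S1 S2 : ℝ) (k : ℕ) (y : Fin 3 → ℝ) : ℝ :=
  fpFluxPre S1 S2 y * (fpSq y)⁻¹ ^ k

/-- Cell coefficient integral `A_T(m₁,m₂) = ∫_T g₃ λ_{m₁} λ_{m₂}`. -/
def p1FluxA (S1 S2 a h : ℝ) (i : (ℤ × ℤ × ℤ) × Fin 6) (m₁ m₂ : Fin 4) : ℝ :=
  ∫ y in p1RealCell a h i, fpFluxProfile S1 S2 3 y * (p1Lam a h i m₁ y * p1Lam a h i m₂ y)

/-- Cell coefficient integral `B_T(m₁,m₂,j,l) = ∫_T g₄ λ_{m₁} λ_{m₂} y_j y_l`. -/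
def p1FluxB (S1 S2 a h : ℝ) (i : (ℤ × ℤ × ℤ) × Fin 6) (m₁ m₂ : Fin 4) (j l : Fin 3) : ℝ :=
  ∫ y in p1RealCell a h i, fpFluxProfile S1 S2 4 y * (p1Lam a h i m₁ y * p1Lam a h i m₂ y * (y j * y l))

/-- Cell coefficient integral `C_T(m,j) = ∫_T g₃ λ_m y_j`. -/
def p1FluxC (S1 S2 a h : ℝ) (i : (ℤ × ℤ × ℤ) × Fin 6) (m : Fin 4) (j : Fin 3) : ℝ :=
  ∫ y in p1RealCell a h i, fpFluxProfile S1 S2 3 y * (p1Lam a h i m y * y j)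

/-- **The cell flux form**: the explicit finite-dimensional expression, in the four vertex values `W` and the element gradient `G`
(`G k j = ∂ₖvⱼ`), of the flux integral over one cell for the generic flux `aΦ₁ + bΦ₂ + cΦ₃ + nΨ₁`. -/
def p1FluxCellForm (S1 S2 ca cb cc cn a h : ℝ) (i : (ℤ × ℤ × ℤ) × Fin 6) (W : Fin 4 → Fin 3 → ℝ) (G : Fin 3 → Fin 3 → ℝ) : ℝ :=
  (∑ m₁ : Fin 4, ∑ m₂ : Fin 4, (ca * ∑ k : Fin 3, W m₁ k * W m₂ k) * p1FluxA S1 S2 a h i m₁ m₂) +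
    (∑ m₁ : Fin 4, ∑ m₂ : Fin 4, ∑ j : Fin 3, ∑ l : Fin 3, ((cb + cc) * (W m₁ j * W m₂ l)) * p1FluxB S1 S2 a h i m₁ m₂ j l) +
      ∑ m : Fin 4, ∑ j : Fin 3, (cn * ((∑ k : Fin 3, W m k * G k j) - fpTr G * W m j)) * p1FluxC S1 S2 a h i m j

/-! ## Pointwise algebra -/

/-- The interface density at a point as a function of the value `w` and the gradient `G`:
`D(y,w,G) = a·s⁻³|w|² + (b+c)·s⁻⁴⟪y,w⟫² + n·s⁻³(Σᵢⱼ wᵢGᵢⱼyⱼ − tr G ⟪y,w⟫)`. -/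
def fpFluxDensity (ca cb cc cn : ℝ) (y w : Fin 3 → ℝ) (G : Fin 3 → Fin 3 → ℝ) : ℝ :=
  ca * ((fpSq y)⁻¹ ^ 3 * fpSq w) + (cb + cc) * ((fpSq y)⁻¹ ^ 4 * fpDot y w ^ 2) +
    cn * ((fpSq y)⁻¹ ^ 3 * (fpVGX y w G - fpTr G * fpDot y w))

/-- `2χ⟪∇χ, Φ(v)⟫(y) = 4χ(y)χ′(y)·D(y, v y, ∇v y)` for the ledger weight. -/
theorem two_chi_fpFlux4DotGrad_eq_density (S1 S2 ca cb cc cn : ℝ) (v : (Fin 3 → ℝ) → (Fin 3 → ℝ)) (y : Fin 3 → ℝ) :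
    2 * fpChi S1 S2 y * fpFlux4DotGrad ca cb cc cn v (fpChi S1 S2) y =
      fpFluxPre S1 S2 y * fpFluxDensity ca cb cc cn y (v y) (fpGrad v y) := by
  rw [two_chi_fpFlux4DotGrad_fpChi]
  rfl

/-- **The weighted density of a barycentric combination `w = Σ_m λ_m W_m` expands into the `A/B/C` monomials** (pure algebra). -/
theorem fpFluxPre_mul_density_barycentric (S1 S2 ca cb cc cn : ℝ) (y : Fin 3 → ℝ) (lam : Fin 4 → ℝ) (W : Fin 4 → Fin 3 → ℝ)
    (G : Fin 3 → Fin 3 → ℝ) :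
    fpFluxPre S1 S2 y * fpFluxDensity ca cb cc cn y (fun k => ∑ m : Fin 4, lam m * W m k) G =
      (∑ m₁ : Fin 4, ∑ m₂ : Fin 4, (ca * ∑ k : Fin 3, W m₁ k * W m₂ k) * (fpFluxProfile S1 S2 3 y * (lam m₁ * lam m₂))) +
        (∑ m₁ : Fin 4, ∑ m₂ : Fin 4, ∑ j : Fin 3, ∑ l : Fin 3,
          ((cb + cc) * (W m₁ j * W m₂ l)) * (fpFluxProfile S1 S2 4 y * (lam m₁ * lam m₂ * (y j * y l)))) +
        ∑ m : Fin 4, ∑ j : Fin 3, (cn * ((∑ k : Fin 3, W m k * G k j) - fpTr G * W m j)) * (fpFluxProfile S1 S2 3 y * (lam m * y j)) := by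
  simp only [fpFluxDensity, fpFluxProfile, fpSq, fpDot, fpVGX, fpTr, Fin.sum_univ_four, Fin.sum_univ_three]
  ring

/-! ## Boundedness of the profiles; integrability on a cell -/

/-- `|S₁(t)| ≤ 30`. -/
theorem abs_fpSmoothstep1_le (t : ℝ) : |fpSmoothstep1 t| ≤ 30 := by
  by_cases h0 : t ≤ 0
  · rw [fpSmoothstep1_of_nonpos h0, abs_zero]; norm_num
  by_cases h1 : 1 ≤ t
  · rw [fpSmoothstep1_of_one_le h1, abs_zero]; norm_num
  push Not at h0 h1
  rw [fpSmoothstep1_of_mem h0.le h1.le, abs_of_nonneg (by positivity)]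
  have ht : t * (1 - t) ≤ 1 := by nlinarith [sq_nonneg (t - 1 / 2)]
  have ht0 : 0 ≤ t * (1 - t) := mul_nonneg h0.le (by linarith)
  nlinarith [mul_le_mul ht ht ht0 zero_le_one]

/-- `|χ| ≤ 1`. -/
theorem abs_fpChi_le_one (S1 S2 : ℝ) (y : Fin 3 → ℝ) : |fpChi S1 S2 y| ≤ 1 := by
  unfold fpChi fpSmoothstep
  split_ifs with h0 h1
  · simp
  · simp
  · push Not at h0 h1
    set t := (fpSq y - S1) / (S2 - S1)
    have ht3 : 0 ≤ t ^ 3 := by positivity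
    have hq : 10 - 15 * t + 6 * t ^ 2 ≤ 10 := by nlinarith
    have hq0 : 0 ≤ 10 - 15 * t + 6 * t ^ 2 := by nlinarith [sq_nonneg (t - 1)]
    rw [abs_of_nonneg (mul_nonneg ht3 hq0)]
    -- `t³(10 − 15t + 6t²) ≤ 1` on `[0,1]`: it is the smoothstep, increasing with value 1 at 1
    nlinarith [mul_nonneg ht3 hq0, sq_nonneg (1 - t), mul_nonneg (mul_nonneg h0.le h0.le) (sub_nonneg.2 h1.le),
      mul_nonneg (sq_nonneg (1 - t)) h0.le, mul_nonneg (mul_nonneg (sq_nonneg (1 - t)) h0.le) h0.le,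
      mul_nonneg (mul_nonneg (sq_nonneg (1 - t)) (sub_nonneg.2 h1.le)) (mul_nonneg h0.le h0.le)]

/-- The prefactor is bounded, `|4χχ′| ≤ 120/(S₂−S₁)`, and vanishes for `|y|² ≤ S₁`. -/
theorem abs_fpFluxPre_le {S1 S2 : ℝ} (hS12 : S1 < S2) (y : Fin 3 → ℝ) : |fpFluxPre S1 S2 y| ≤ 120 / (S2 - S1) := by
  have hdS : 0 < S2 - S1 := sub_pos.2 hS12
  unfold fpFluxPre
  rw [abs_mul, abs_mul, abs_div, abs_of_pos hdS, abs_of_pos (by norm_num : (0 : ℝ) < 4)]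
  have h1 := abs_fpChi_le_one S1 S2 y
  have h2 := abs_fpSmoothstep1_le ((fpSq y - S1) / (S2 - S1))
  calc 4 * |fpChi S1 S2 y| * (|fpSmoothstep1 ((fpSq y - S1) / (S2 - S1))| / (S2 - S1)) ≤ 4 * 1 * (30 / (S2 - S1)) := by
        gcongr
    _ = 120 / (S2 - S1) := by ring

/-- The prefactor vanishes inside the inner sphere: `4χχ′ = 0` for `|y|² ≤ S₁`. -/
theorem fpFluxPre_eq_zero_of_le {S1 S2 : ℝ} (hS12 : S1 < S2) {y : Fin 3 → ℝ} (hy : fpSq y ≤ S1) : fpFluxPre S1 S2 y = 0 := by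
  have ht : (fpSq y - S1) / (S2 - S1) ≤ 0 := div_nonpos_of_nonpos_of_nonneg (sub_nonpos.2 hy) (sub_pos.2 hS12).le
  simp [fpFluxPre, fpSmoothstep1_of_nonpos ht]

/-- The profiles are bounded: `|g_k| ≤ 120/(S₂−S₁)·S₁⁻ᵏ` (for `0 < S₁ < S₂`). -/
theorem abs_fpFluxProfile_le {S1 S2 : ℝ} (hS1 : 0 < S1) (hS12 : S1 < S2) (k : ℕ) (y : Fin 3 → ℝ) :
    |fpFluxProfile S1 S2 k y| ≤ 120 / (S2 - S1) * (S1⁻¹) ^ k := by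
  have hdS : 0 < S2 - S1 := sub_pos.2 hS12
  unfold fpFluxProfile
  by_cases hs : fpSq y ≤ S1
  · rw [fpFluxPre_eq_zero_of_le hS12 hs, zero_mul, abs_zero]; positivity
  · push Not at hs
    have hinv : (fpSq y)⁻¹ ≤ S1⁻¹ := by rw [inv_le_inv₀ (hS1.trans hs) hS1]; exact hs.le
    have hinv0 : 0 ≤ (fpSq y)⁻¹ := inv_nonneg.2 (fpSq_nonneg y)
    rw [abs_mul, abs_of_nonneg (pow_nonneg hinv0 k)]
    exact mul_le_mul (abs_fpFluxPre_le hS12 y) (pow_le_pow_left₀ hinv0 hinv k) (pow_nonneg hinv0 k) (by positivity)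

/-- The profiles are measurable. -/
theorem measurable_fpFluxProfile (S1 S2 : ℝ) (k : ℕ) : Measurable (fpFluxProfile S1 S2 k) := by
  have h1 : Continuous (fpChi S1 S2) := (contDiff_two_fpChi S1 S2).continuous
  have hS : Continuous fpSmoothstep1 := continuous_iff_continuousAt.2 fun t => (hasDerivAt_fpSmoothstep1 t).continuousAt
  have h2 : Continuous fun y : Fin 3 → ℝ => fpSmoothstep1 ((fpSq y - S1) / (S2 - S1)) :=
    hS.comp ((continuous_fpSq.sub continuous_const).div_const _)
  have hpre : Continuous (fpFluxPre S1 S2) := by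
    unfold fpFluxPre
    exact (continuous_const.mul h1).mul (h2.div_const _)
  have h3 : Measurable fun y : Fin 3 → ℝ => (fpSq y)⁻¹ ^ k := (continuous_fpSq.measurable.inv).pow_const k
  unfold fpFluxProfile
  exact hpre.measurable.mul h3

/-- A bounded measurable weight times a continuous function is integrable on a (compact) cell. -/
theorem integrableOn_p1RealCell_of_bounded {a h : ℝ} (ha : a ≠ 0) (hh : h ≠ 0) (i : (ℤ × ℤ × ℤ) × Fin 6)
    {g : (Fin 3 → ℝ) → ℝ} (hg : Measurable g) {M : ℝ} (hM : ∀ y, |g y| ≤ M) {f : (Fin 3 → ℝ) → ℝ} (hf : Continuous f) :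
    IntegrableOn (fun y => g y * f y) (p1RealCell a h i) := by
  have hK := isCompact_p1RealCell ha hh i
  obtain ⟨B, hB⟩ := hK.exists_bound_of_continuousOn (f := f) hf.continuousOn
  have hmeas : AEStronglyMeasurable (fun y => g y * f y) volume := (hg.mul hf.measurable).aestronglyMeasurable
  refine Measure.integrableOn_of_bounded (M := M * B) hK.measure_lt_top.ne hmeas ?_
  filter_upwards [ae_restrict_mem (isClosed_p1RealCell a h i).measurableSet] with y hy
  rw [norm_mul, Real.norm_eq_abs]
  exact mul_le_mul (hM y) (hB y hy) (norm_nonneg _) ((abs_nonneg _).trans (hM y))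

/-! ## The flux integral over one cell -/

section cell
variable {a h S1 S2 : ℝ} (ha : 0 < a) (hh : 0 < h) (hS1 : 0 < S1) (hS12 : S1 < S2) (i : (ℤ × ℤ × ℤ) × Fin 6)
include ha hh hS1 hS12

/-- The `A`-integrands `g₃λλ` are integrable on the cell. -/
theorem integrableOn_fluxA (m₁ m₂ : Fin 4) :
    IntegrableOn (fun y => fpFluxProfile S1 S2 3 y * (p1Lam a h i m₁ y * p1Lam a h i m₂ y)) (p1RealCell a h i) :=
  integrableOn_p1RealCell_of_bounded ha.ne' hh.ne' i (measurable_fpFluxProfile S1 S2 3) (abs_fpFluxProfile_le hS1 hS12 3)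
    ((continuous_p1Lam a h i m₁).mul (continuous_p1Lam a h i m₂))

/-- The `B`-integrands `g₄λλ·y_jy_l` are integrable on the cell. -/
theorem integrableOn_fluxB (m₁ m₂ : Fin 4) (j l : Fin 3) :
    IntegrableOn (fun y => fpFluxProfile S1 S2 4 y * (p1Lam a h i m₁ y * p1Lam a h i m₂ y * (y j * y l))) (p1RealCell a h i) :=
  integrableOn_p1RealCell_of_bounded ha.ne' hh.ne' i (measurable_fpFluxProfile S1 S2 4) (abs_fpFluxProfile_le hS1 hS12 4)
    (((continuous_p1Lam a h i m₁).mul (continuous_p1Lam a h i m₂)).mul ((continuous_apply j).mul (continuous_apply l)))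

/-- The `C`-integrands `g₃λ·y_j` are integrable on the cell. -/
theorem integrableOn_fluxC (m : Fin 4) (j : Fin 3) :
    IntegrableOn (fun y => fpFluxProfile S1 S2 3 y * (p1Lam a h i m y * y j)) (p1RealCell a h i) :=
  integrableOn_p1RealCell_of_bounded ha.ne' hh.ne' i (measurable_fpFluxProfile S1 S2 3) (abs_fpFluxProfile_le hS1 hS12 3)
    ((continuous_p1Lam a h i m).mul (continuous_apply j))

/-- **On one cell the flux integral of the far-ledger field is the cell flux form** of its vertex values and element gradient. -/
theorem setIntegral_flux_p1Disp_p1RealCell (ca cb cc cn : ℝ) (U : ℤ × ℤ × ℤ → (Fin 3 → ℝ)) (b₀ : Fin 3 → ℝ)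
    (A : Fin 3 → Fin 3 → ℝ) :
    ∫ y in p1RealCell a h i, 2 * fpChi S1 S2 y * fpFlux4DotGrad ca cb cc cn (p1Disp a h U b₀ A) (fpChi S1 S2) y =
      p1FluxCellForm S1 S2 ca cb cc cn a h i (p1CellVals (fun n k => p1DispSite a h U b₀ A n k) i)
        (fun j k => p1CellGrad a h U i j k - A j k) := by
  have ha' := ha.ne'
  have hh' := hh.ne'
  have hmeas := (isClosed_p1RealCell a h i).measurableSet
  -- (1) a.e. on the cell: gradient = G, value = Σ_m λ_m W_m
  have hvq : ∀ y ∈ p1RealCell a h i, p1Disp a h U b₀ A y =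
      fun k => ∑ m : Fin 4, p1Lam a h i m y * p1CellVals (fun n k => p1DispSite a h U b₀ A n k) i m k := by
    intro y hy
    rw [p1Disp_eq_p1Field ha' hh' U b₀ A, p1Field_eq_sum_p1Lam _ hy]
  have h1 : ∫ y in p1RealCell a h i, 2 * fpChi S1 S2 y * fpFlux4DotGrad ca cb cc cn (p1Disp a h U b₀ A) (fpChi S1 S2) y =
      ∫ y in p1RealCell a h i, fpFluxPre S1 S2 y * fpFluxDensity ca cb cc cn y
        (fun k => ∑ m : Fin 4, p1Lam a h i m y * p1CellVals (fun n k => p1DispSite a h U b₀ A n k) i m k)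
        (fun j k => p1CellGrad a h U i j k - A j k) := by
    refine setIntegral_congr_ae hmeas ((fpGrad_p1Disp_ae ha' hh' U b₀ A i).mono fun y hy hmem => ?_)
    rw [two_chi_fpFlux4DotGrad_eq_density, hy hmem, hvq y hmem]
  rw [h1]
  simp only [fpFluxPre_mul_density_barycentric]
  -- (2) linearity: split the three sums and pull the constants
  have hIA : ∀ m₁ m₂ : Fin 4, Integrable (fun y => (ca * ∑ k : Fin 3,
      p1CellVals (fun n k => p1DispSite a h U b₀ A n k) i m₁ k * p1CellVals (fun n k => p1DispSite a h U b₀ A n k) i m₂ k) *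
        (fpFluxProfile S1 S2 3 y * (p1Lam a h i m₁ y * p1Lam a h i m₂ y))) (volume.restrict (p1RealCell a h i)) :=
    fun m₁ m₂ => (integrableOn_fluxA ha hh hS1 hS12 i m₁ m₂).const_mul _
  have hIB : ∀ (m₁ m₂ : Fin 4) (j l : Fin 3), Integrable (fun y => ((cb + cc) *
      (p1CellVals (fun n k => p1DispSite a h U b₀ A n k) i m₁ j * p1CellVals (fun n k => p1DispSite a h U b₀ A n k) i m₂ l)) *
        (fpFluxProfile S1 S2 4 y * (p1Lam a h i m₁ y * p1Lam a h i m₂ y * (y j * y l)))) (volume.restrict (p1RealCell a h i)) :=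
    fun m₁ m₂ j l => (integrableOn_fluxB ha hh hS1 hS12 i m₁ m₂ j l).const_mul _
  have hIC : ∀ (m : Fin 4) (j : Fin 3), Integrable (fun y => (cn *
      ((∑ k : Fin 3, p1CellVals (fun n k => p1DispSite a h U b₀ A n k) i m k * (p1CellGrad a h U i k j - A k j)) -
        fpTr (fun j k => p1CellGrad a h U i j k - A j k) * p1CellVals (fun n k => p1DispSite a h U b₀ A n k) i m j)) *
        (fpFluxProfile S1 S2 3 y * (p1Lam a h i m y * y j))) (volume.restrict (p1RealCell a h i)) :=
    fun m j => (integrableOn_fluxC ha hh hS1 hS12 i m j).const_mul _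
  have hSA : Integrable (fun y => ∑ m₁ : Fin 4, ∑ m₂ : Fin 4, (ca * ∑ k : Fin 3,
      p1CellVals (fun n k => p1DispSite a h U b₀ A n k) i m₁ k * p1CellVals (fun n k => p1DispSite a h U b₀ A n k) i m₂ k) *
        (fpFluxProfile S1 S2 3 y * (p1Lam a h i m₁ y * p1Lam a h i m₂ y))) (volume.restrict (p1RealCell a h i)) :=
    integrable_finsetSum _ fun m₁ _ => integrable_finsetSum _ fun m₂ _ => hIA m₁ m₂
  have hSB : Integrable (fun y => ∑ m₁ : Fin 4, ∑ m₂ : Fin 4, ∑ j : Fin 3, ∑ l : Fin 3, ((cb + cc) *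
      (p1CellVals (fun n k => p1DispSite a h U b₀ A n k) i m₁ j * p1CellVals (fun n k => p1DispSite a h U b₀ A n k) i m₂ l)) *
        (fpFluxProfile S1 S2 4 y * (p1Lam a h i m₁ y * p1Lam a h i m₂ y * (y j * y l)))) (volume.restrict (p1RealCell a h i)) :=
    integrable_finsetSum _ fun m₁ _ => integrable_finsetSum _ fun m₂ _ =>
      integrable_finsetSum _ fun j _ => integrable_finsetSum _ fun l _ => hIB m₁ m₂ j l
  have hSC : Integrable (fun y => ∑ m : Fin 4, ∑ j : Fin 3, (cn *
      ((∑ k : Fin 3, p1CellVals (fun n k => p1DispSite a h U b₀ A n k) i m k * (p1CellGrad a h U i k j - A k j)) -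
        fpTr (fun j k => p1CellGrad a h U i j k - A j k) * p1CellVals (fun n k => p1DispSite a h U b₀ A n k) i m j)) *
        (fpFluxProfile S1 S2 3 y * (p1Lam a h i m y * y j))) (volume.restrict (p1RealCell a h i)) :=
    integrable_finsetSum _ fun m _ => integrable_finsetSum _ fun j _ => hIC m j
  have hSAB : Integrable (fun y => (∑ m₁ : Fin 4, ∑ m₂ : Fin 4, (ca * ∑ k : Fin 3,
      p1CellVals (fun n k => p1DispSite a h U b₀ A n k) i m₁ k * p1CellVals (fun n k => p1DispSite a h U b₀ A n k) i m₂ k) *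
        (fpFluxProfile S1 S2 3 y * (p1Lam a h i m₁ y * p1Lam a h i m₂ y))) +
      ∑ m₁ : Fin 4, ∑ m₂ : Fin 4, ∑ j : Fin 3, ∑ l : Fin 3, ((cb + cc) *
      (p1CellVals (fun n k => p1DispSite a h U b₀ A n k) i m₁ j * p1CellVals (fun n k => p1DispSite a h U b₀ A n k) i m₂ l)) *
        (fpFluxProfile S1 S2 4 y * (p1Lam a h i m₁ y * p1Lam a h i m₂ y * (y j * y l)))) (volume.restrict (p1RealCell a h i)) :=
    hSA.add hSB
  rw [integral_add hSAB hSC, integral_add hSA hSB]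
  unfold p1FluxCellForm p1FluxA p1FluxB p1FluxC
  congr 1
  congr 1
  · rw [integral_finsetSum _ fun m₁ _ => integrable_finsetSum _ fun m₂ _ => hIA m₁ m₂]
    refine Finset.sum_congr rfl fun m₁ _ => ?_
    rw [integral_finsetSum _ fun m₂ _ => hIA m₁ m₂]
    refine Finset.sum_congr rfl fun m₂ _ => ?_
    rw [integral_const_mul]
  · rw [integral_finsetSum _ fun m₁ _ => integrable_finsetSum _ fun m₂ _ =>
      integrable_finsetSum _ fun j _ => integrable_finsetSum _ fun l _ => hIB m₁ m₂ j l]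
    refine Finset.sum_congr rfl fun m₁ _ => ?_
    rw [integral_finsetSum _ fun m₂ _ => integrable_finsetSum _ fun j _ => integrable_finsetSum _ fun l _ => hIB m₁ m₂ j l]
    refine Finset.sum_congr rfl fun m₂ _ => ?_
    rw [integral_finsetSum _ fun j _ => integrable_finsetSum _ fun l _ => hIB m₁ m₂ j l]
    refine Finset.sum_congr rfl fun j _ => ?_
    rw [integral_finsetSum _ fun l _ => hIB m₁ m₂ j l]
    refine Finset.sum_congr rfl fun l _ => ?_
    rw [integral_const_mul]
  · rw [integral_finsetSum _ fun m _ => integrable_finsetSum _ fun j _ => hIC m j]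
    refine Finset.sum_congr rfl fun m _ => ?_
    rw [integral_finsetSum _ fun j _ => hIC m j]
    refine Finset.sum_congr rfl fun j _ => ?_
    rw [integral_const_mul]

end cell

/-! ## Integrability of the interface integrand and the global identity -/

/-- The interface integrand of the far-ledger field is integrable (compact collar × Lipschitz field with linear growth). -/
theorem integrable_flux_p1Disp {a h S1 S2 : ℝ} (ha : 0 < a) (hh : 0 < h) (hS1 : 0 < S1) (hS12 : S1 < S2) (ca cb cc cn : ℝ)
    (U : ℤ × ℤ × ℤ → (Fin 3 → ℝ)) (hU : (support U).Finite) (b₀ : Fin 3 → ℝ) (A : Fin 3 → Fin 3 → ℝ) :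
    Integrable fun x => 2 * fpChi S1 S2 x * fpFlux4DotGrad ca cb cc cn (p1Disp a h U b₀ A) (fpChi S1 S2) x := by
  obtain ⟨K, hK⟩ := exists_lipschitzWith_p1Disp ha.ne' hh.ne' U hU b₀ A
  have hχ : ContDiff ℝ 2 (fpChi S1 S2) := contDiff_two_fpChi S1 S2
  have hχ0 : (0 : Fin 3 → ℝ) ∉ tsupport (fpChi S1 S2) := zero_notMem_tsupport_fpChi hS1 hS12
  have hS2 : (0 : ℝ) ≤ Real.sqrt S2 := Real.sqrt_nonneg _
  have hχ1 : ∀ y : Fin 3 → ℝ, Real.sqrt S2 ≤ ‖y‖ → fpChi S1 S2 y = 1 :=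
    fun y hy => fpChi_eq_one_of_norm_ge hS12 hS2 (by rw [Real.sq_sqrt (hS1.trans hS12).le]) y hy
  set V : ℝ := ‖p1Disp a h U b₀ A 0‖ with hV
  have hK0 : (0 : ℝ) ≤ K := K.2
  have hV0 : 0 ≤ V := norm_nonneg _
  have hGn : ∀ x i j, |fpGrad (p1Disp a h U b₀ A) x i j| ≤ K := fun x i j => abs_fpGrad_le_of_lipschitz hK x i j
  have hwn : ∀ x, ‖p1Disp a h U b₀ A x‖ ≤ V + K * ‖x‖ := fun x => norm_le_of_lipschitz hK x
  refine Integrable.mono' (integrable_fluxBound hχ hχ0 hχ1 (6 * |cn|) (3 * |ca| + 3 * |cb| + 9 * |cc|) K V)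
    (measurable_two_chi_flux4DotGrad ca cb cc cn (continuous_p1Disp a h U b₀ A) hχ).aestronglyMeasurable
    (ae_of_all _ fun x => ?_)
  have hB : ∀ j, |fpFlux4 ca cb cc cn (p1Disp a h U b₀ A) x j| ≤
      (3 * |ca| + 3 * |cb| + 9 * |cc|) * (fpSq x)⁻¹ ^ 4 * ‖x‖ * (V + K * ‖x‖) ^ 2 + 6 * |cn| * K * (fpSq x)⁻¹ ^ 3 * (V + K * ‖x‖) :=
    fun j => abs_fpFlux4_le ca cb cc cn hK0 (by nlinarith [norm_nonneg x]) (hGn x) (hwn x) j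
  set B := (3 * |ca| + 3 * |cb| + 9 * |cc|) * (fpSq x)⁻¹ ^ 4 * ‖x‖ * (V + K * ‖x‖) ^ 2 +
      6 * |cn| * K * (fpSq x)⁻¹ ^ 3 * (V + K * ‖x‖) with hBdef
  set χ := fpChi S1 S2 with hχdef
  rw [Real.norm_eq_abs]
  unfold fpFlux4DotGrad
  have e : ∀ j, |2 * χ x * (fpGradS χ x j * fpFlux4 ca cb cc cn (p1Disp a h U b₀ A) x j)| ≤ |2 * χ x * fpGradS χ x j| * B :=
    fun j => by
      rw [← mul_assoc, abs_mul]
      exact mul_le_mul_of_nonneg_left (hB j) (abs_nonneg _)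
  calc |2 * χ x * (fpGradS χ x 0 * fpFlux4 ca cb cc cn (p1Disp a h U b₀ A) x 0 +
          fpGradS χ x 1 * fpFlux4 ca cb cc cn (p1Disp a h U b₀ A) x 1 + fpGradS χ x 2 * fpFlux4 ca cb cc cn (p1Disp a h U b₀ A) x 2)|
      = |2 * χ x * (fpGradS χ x 0 * fpFlux4 ca cb cc cn (p1Disp a h U b₀ A) x 0) +
          2 * χ x * (fpGradS χ x 1 * fpFlux4 ca cb cc cn (p1Disp a h U b₀ A) x 1) +
          2 * χ x * (fpGradS χ x 2 * fpFlux4 ca cb cc cn (p1Disp a h U b₀ A) x 2)| := by ring_nf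
    _ ≤ |2 * χ x * (fpGradS χ x 0 * fpFlux4 ca cb cc cn (p1Disp a h U b₀ A) x 0)| +
          |2 * χ x * (fpGradS χ x 1 * fpFlux4 ca cb cc cn (p1Disp a h U b₀ A) x 1)| +
          |2 * χ x * (fpGradS χ x 2 * fpFlux4 ca cb cc cn (p1Disp a h U b₀ A) x 2)| := abs_add_three _ _ _
    _ ≤ |2 * χ x * fpGradS χ x 0| * B + |2 * χ x * fpGradS χ x 1| * B + |2 * χ x * fpGradS χ x 2| * B := by
          linarith [e 0, e 1, e 2]
    _ = (|2 * χ x * fpGradS χ x 0| + |2 * χ x * fpGradS χ x 1| + |2 * χ x * fpGradS χ x 2|) * B := by ring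

/-- **FLUX IDENTIFICATION (item (3) of FAR-LEMMA-SPEC §20 (e), kernel half).**  For `0 < a, h`, `0 < S₁ < S₂`, any finitely supported
lattice displacement `U`, any affine part `(b₀, A)` and any flux vector `(a, b, c, n)`, the boundary term of the far theorem for the
far-ledger field `v = p1Disp a h U b₀ A` is the cellwise sum of the cell flux forms of its vertex values and element gradients:
`∫ 2χ⟪∇χ, Φ(v)⟫ = Σ'_T p1FluxCellForm(T)(W_T, G_T)`.  NOT a proof of H12⋆, NOT summit progress. -/
theorem integral_flux_p1Disp_eq_tsum {a h S1 S2 : ℝ} (ha : 0 < a) (hh : 0 < h) (hS1 : 0 < S1) (hS12 : S1 < S2)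
    (ca cb cc cn : ℝ) (U : ℤ × ℤ × ℤ → (Fin 3 → ℝ)) (hU : (support U).Finite) (b₀ : Fin 3 → ℝ) (A : Fin 3 → Fin 3 → ℝ) :
    ∫ x, 2 * fpChi S1 S2 x * fpFlux4DotGrad ca cb cc cn (p1Disp a h U b₀ A) (fpChi S1 S2) x =
      ∑' i, p1FluxCellForm S1 S2 ca cb cc cn a h i (p1CellVals (fun n k => p1DispSite a h U b₀ A n k) i)
        (fun j k => p1CellGrad a h U i j k - A j k) := by
  rw [integral_eq_tsum_p1RealCell ha.ne' hh.ne' (integrable_flux_p1Disp ha hh hS1 hS12 ca cb cc cn U hU b₀ A)]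
  exact tsum_congr fun i => setIntegral_flux_p1Disp_p1RealCell ha hh hS1 hS12 i ca cb cc cn U b₀ A

/-- **Instance F2 (the certificate of the matched split)**: the boundary term of `farPencilF2_weighted_integral_le_p1Disp` is the cellwise
sum of the cell flux forms with flux vector `(1/3, 4/3, −9/8, 1/8)` (near channels `(a, b+c, n) = (1/3, 5/24, 1/8)`).
NOT a proof of H12⋆, NOT summit progress. -/
theorem integral_fluxF2_p1Disp_eq_tsum {a h : ℝ} (ha : 0 < a) (hh : 0 < h) (U : ℤ × ℤ × ℤ → (Fin 3 → ℝ)) (hU : (support U).Finite)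
    (b₀ : Fin 3 → ℝ) (A : Fin 3 → Fin 3 → ℝ) {R1 R2 : ℝ} (hR1 : 0 < R1) (hR12 : R1 < R2) :
    ∫ x, 2 * fpChi (R1 ^ 2) (R2 ^ 2) x * fpFlux4DotGrad (1 / 3) (4 / 3) (-9 / 8) (1 / 8) (p1Disp a h U b₀ A) (fpChi (R1 ^ 2) (R2 ^ 2)) x =
      ∑' i, p1FluxCellForm (R1 ^ 2) (R2 ^ 2) (1 / 3) (4 / 3) (-9 / 8) (1 / 8) a h i
        (p1CellVals (fun n k => p1DispSite a h U b₀ A n k) i) (fun j k => p1CellGrad a h U i j k - A j k) :=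
  integral_flux_p1Disp_eq_tsum ha hh (pow_pos hR1 2) (pow_lt_pow_left₀ hR12 hR1.le two_ne_zero) _ _ _ _ U hU b₀ A

end Summit.AtomisticToContinuum.Crystallization.Theorems.StrictSplittingRuleBirth

end
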